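import Literature.Geometry.Kaehler.HolomorphicChainFacts
import Literature.Geometry.GeometricMeasureTheory.DilationInvariance
import Literature.Geometry.GeometricMeasureTheory.CurrentsDilation
import Literature.Geometry.GeometricMeasureTheory.CurrentsRestrict
import HarnessLib

/-!
# Blow-ups of holomorphic chains are locally rectifiable

A proved brick towards the named fact `Literature.Geometry.Kaehler.King1971_tangentCone`
(King's tangent cone theorem [Harvey1977, Thm. 1.31]; [Federer1969, 4.3.16–4.3.19]): the
blown-up currents `HolomorphicChain.blowUp T b r = (1/r)_*(τ_{-b})_*[T]` on the unit ball are
locally rectifiable, with the transported data.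

* `HolomorphicChain.isRectifiableData_blowUp` — for `0 < r` with `B(b,r) ⊆ Ω`, the data
  `({y : b + r y ∈ reg |T|} ∩ B(0,1), θ_T(b + r ·), ξ_T(b + r ·))` DEFINING
  `HolomorphicChain.blowUp T b r` are admissible rectifiable data on `B(0,1)` whenever
  `(reg |T|, θ_T, ξ_T)` are admissible on `Ω` (dilation calculus of
  `Literature/Geometry/GeometricMeasureTheory/DilationInvariance.lean`: `𝓗^{2p}` scales by
  `r^{2p}`, approximate tangent cones are dilation invariant, local summability is transported);
* `HolomorphicChain.isLocallyRectifiable_blowUp` — hence, under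
  `Harvey1977_isRectifiableData_toCurrent`, `(1/r)_*(τ_{-b})_*[T] ∈ 𝓡^{loc}_{2p}(B(0,1))`
  [Federer1969, 4.3.16: `f_#` maps `𝓕^{loc}` into `𝓕^{loc}`; here for dilations and locally
  rectifiable currents].

* `HolomorphicChain.blowUp_apply`, `HolomorphicChain.mass_blowUp_le` — the push-forward formula
  `(1/r)_*(τ_{-b})_*[T](ψ ∘ A) = r^{-2p} [T]|_{B(b,r)}(ψ)` and Harvey's mass identity in the form
  **`𝐌_{B(0,1)}((1/r)_* T) ≤ r^{-2p} 𝐌_{B(b,r)}(T)`** [Harvey1977, §1.10] (`[T]|_{B(b,r)}` being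
  `T.toCurrentIn ⟨B(b,r), _⟩`);
* `HolomorphicChain.boundary_blowUp_eq_zero` — **blow-ups of holomorphic chains are cycles**:
  `∂((1/r)_*(τ_{-b})_*[T]) = 0` on `B(0,1)` when `∂[T] = 0` on `Ω` (the content of
  `Harvey1977_boundary_toCurrent_eq_zero`), since `∂` commutes with restriction and with `f_#`;
  primed versions take the two named facts as hypotheses.

## References

* H. Federer, *Geometric Measure Theory*, Springer 1969, 4.1.7, 4.1.14, 4.1.28, 4.3.16 [Federer1969].
* R. Harvey, *Holomorphic chains and their boundaries*, PSPUM XXX.1 (1977), §1.10 [Harvey1977].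
-/

open scoped Manifold ContDiff Topology ENNReal Pointwise
open Set Filter MeasureTheory

namespace Literature.Geometry.Kaehler

open Literature.Geometry.GeometricMeasureTheory

-- Nested operator-norm instances on `Covector V m`, as in `Currents.lean`.
set_option maxSynthPendingDepth 2

universe u

/-! ### The blow-ups are locally rectifiable currents on the unit ball -/

section BlowUpRectifiable

variable {V : Type*} [NormedAddCommGroup V] [InnerProductSpace ℂ V]
  [MeasurableSpace V] [BorelSpace V] {Ω : TopologicalSpace.Opens V} {p : ℕ}

omit [MeasurableSpace V] [BorelSpace V] in
/-- `A(B(0,1)) = B(b, r)` up to inclusion: the dilation `y ↦ b + r • y` (`r > 0`) maps the unit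
ball into `B(b, r)`. [folklore] -/
theorem image_add_smul_unitBall_subset (b : V) {r : ℝ} (hr : 0 < r) :
    (fun y : V => b + r • y) '' Metric.ball (0 : V) 1 ⊆ Metric.ball b r := by
  rintro _ ⟨y, hy, rfl⟩
  rw [Metric.mem_ball, dist_eq_norm, add_sub_cancel_left, norm_smul, Real.norm_eq_abs,
    abs_of_pos hr]
  calc r * ‖y‖ < r * 1 := mul_lt_mul_of_pos_left (mem_ball_zero_iff.1 hy) hr
    _ = r := mul_one r

/-- **The blown-up data are admissible rectifiable data.** If `(reg |T|, θ_T, ξ_T)` are admissible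
rectifiable data on `Ω` (measurable countably `2p`-rectifiable carrier, locally summable density,
a.e. orthonormal tangent frames — the content of `Harvey1977_isRectifiableData_toCurrent`), then
for `0 < r` with `B(b, r) ⊆ Ω` so are the data
`({y : b + r y ∈ reg |T|} ∩ B(0,1), θ_T(b + r ·), ξ_T(b + r ·))` of `HolomorphicChain.blowUp T b r`
on `B(0,1)`: countable rectifiability and `𝓗^{2p}`-null sets pull back under the dilation,
local summability is transported by `A_#(𝓗^{2p} ⌞ A⁻¹W) = r^{-2p} 𝓗^{2p} ⌞ W`, the frames stay
orthonormal, and `Tan^{2p}(𝓗^{2p} ⌞ A⁻¹W, y) = Tan^{2p}(𝓗^{2p} ⌞ W, A y)`.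
[cite: Federer1969, 4.3.16] -/
theorem HolomorphicChain.isRectifiableData_blowUp (T : HolomorphicChain 𝓘(ℂ, V) Ω p)
    (hT : letI : InnerProductSpace ℝ V := InnerProductSpace.complexToReal
      IsRectifiableData Ω (2 * p) T.carrier T.density T.orientationFrame)
    {b : V} {r : ℝ} (hr : 0 < r) (hball : Metric.ball b r ⊆ (Ω : Set V)) :
    letI : InnerProductSpace ℝ V := InnerProductSpace.complexToReal
    IsRectifiableData (unitBall V) (2 * p)
      ((fun y : V => b + r • y) ⁻¹' T.carrier ∩ Metric.ball (0 : V) 1)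
      (fun y => T.density (b + r • y)) (fun y => T.orientationFrame (b + r • y)) := by
  letI : InnerProductSpace ℝ V := InnerProductSpace.complexToReal
  obtain ⟨hmeasW, -, hrect, hint, hae⟩ := hT
  have hmeas : Measurable (fun y : V => b + r • y) := (measurable_const_smul r).const_add b
  have hA : (fun y : V => b + r • y) '' Metric.ball (0 : V) 1 ⊆ (Ω : Set V) :=
    (image_add_smul_unitBall_subset b hr).trans hball
  have hmeasW' : MeasurableSet ((fun y : V => b + r • y) ⁻¹' T.carrier) := hmeasW.preimage hmeas
  refine ⟨hmeasW'.inter measurableSet_ball, Set.inter_subset_right,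
    (hrect.preimage_add_smul b hr).mono Set.inter_subset_left, ?_, ?_⟩
  · -- local summability on `B(0,1)`
    have h := locallyIntegrableOn_comp_add_smul (m := 2 * p)
      (η := fun x => (T.density x : ℝ) • frameVector (T.orientationFrame x)) hmeasW b hr hA hint
    intro y hy
    obtain ⟨u, hu, hu'⟩ := h y hy
    exact ⟨u, hu, hu'.mono_measure (Measure.restrict_mono Set.inter_subset_left le_rfl)⟩
  · -- a.e. orthonormal frames spanning the approximate tangent space
    have h1 : ∀ᵐ x ∂(Measure.map (fun y : V => b + r • y)
        ((μHE[2 * p] : Measure V).restrict ((fun y : V => b + r • y) ⁻¹' T.carrier))),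
        Orthonormal ℝ (T.orientationFrame x) ∧
          ((Submodule.span ℝ (range (T.orientationFrame x)) : Set V) =
            approxTangentCone (2 * p) ((μHE[2 * p] : Measure V).restrict T.carrier) x) := by
      rw [map_add_smul_restrict_preimage b hr]
      exact Measure.ae_smul_measure hae _
    have h2 := ae_of_ae_map hmeas.aemeasurable h1
    have h3 : ∀ᵐ y ∂((μHE[2 * p] : Measure V).restrict
        ((fun y : V => b + r • y) ⁻¹' T.carrier ∩ Metric.ball (0 : V) 1)),
        y ∈ (fun y : V => b + r • y) ⁻¹' T.carrier ∩ Metric.ball (0 : V) 1 :=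
      ae_restrict_mem (hmeasW'.inter measurableSet_ball)
    filter_upwards [ae_mono (Measure.restrict_mono Set.inter_subset_left le_rfl) h2, h3]
      with y hy hyB
    refine ⟨hy.1, ?_⟩
    rw [hy.2, ← approxTangentCone_restrict_preimage_add_smul hmeasW b y hr,
      ← approxTangentCone_restrict_inter_eq_of_isOpen _ hmeasW' Metric.isOpen_ball hyB.2]

/-- **Blow-ups of holomorphic chains are locally rectifiable currents**: under
`Harvey1977_isRectifiableData_toCurrent`, for `0 < r` with `B(b,r) ⊆ Ω` the blow-up
`(1/r)_*(τ_{-b})_*[T]` belongs to `𝓡^{loc}_{2p}(B(0,1))`, with the transported data.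
[cite: Federer1969, 4.3.16] -/
theorem HolomorphicChain.isLocallyRectifiable_blowUp
    (h : Harvey1977_isRectifiableData_toCurrent.{u}) {V : Type u} [NormedAddCommGroup V]
    [InnerProductSpace ℂ V] [FiniteDimensional ℂ V] [MeasurableSpace V] [BorelSpace V]
    {Ω : TopologicalSpace.Opens V} {p : ℕ} (T : HolomorphicChain 𝓘(ℂ, V) Ω p) {b : V} {r : ℝ}
    (hr : 0 < r) (hball : Metric.ball b r ⊆ (Ω : Set V)) :
    letI : InnerProductSpace ℝ V := InnerProductSpace.complexToReal
    (T.blowUp b r).IsLocallyRectifiable :=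
  ⟨_, _, _, T.isRectifiableData_blowUp (h V Ω p T) hr hball, rfl⟩

end BlowUpRectifiable

/-! ### The push-forward formula, the mass bound, and the cycle property of blow-ups -/

section BlowUpMass

variable {V : Type*} [NormedAddCommGroup V] [InnerProductSpace ℂ V]
  [MeasurableSpace V] [BorelSpace V] {Ω : TopologicalSpace.Opens V} {p : ℕ}

/-- **Push-forward formula for the blow-up**: for admissible data, `0 < r`, `B(b,r) ⊆ Ω` and test
forms `φ` on `B(0,1)`, `ψ` on `B(b,r)` with `φ = ψ ∘ A` (`A y = b + r • y`):
`(1/r)_*(τ_{-b})_*[T](φ) = r^{-2p} · [T]|_{B(b,r)}(ψ)`. [cite: Harvey1977, §1.10] -/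
theorem HolomorphicChain.blowUp_apply (T : HolomorphicChain 𝓘(ℂ, V) Ω p)
    (hT : letI : InnerProductSpace ℝ V := InnerProductSpace.complexToReal
      IsRectifiableData Ω (2 * p) T.carrier T.density T.orientationFrame)
    {b : V} {r : ℝ} (hr : 0 < r) (hball : Metric.ball b r ⊆ (Ω : Set V))
    (φ : TestForm (unitBall V) (2 * p))
    (ψ : TestForm (⟨Metric.ball b r, Metric.isOpen_ball⟩ : TopologicalSpace.Opens V) (2 * p))
    (hφψ : ∀ y, φ y = ψ (b + r • y)) :
    T.blowUp b r φ = r⁻¹ ^ (2 * p) *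
      T.toCurrentIn (⟨Metric.ball b r, Metric.isOpen_ball⟩ : TopologicalSpace.Opens V) ψ := by
  letI : InnerProductSpace ℝ V := InnerProductSpace.complexToReal
  obtain ⟨hmeasW, -, -, hint, -⟩ := hT
  exact currentOfIntegration_preimage_add_smul_apply (Ω₁ := unitBall V)
    (Ω₂ := (⟨Metric.ball b r, Metric.isOpen_ball⟩ : TopologicalSpace.Opens V)) hmeasW T.density
    T.orientationFrame b hr (image_add_smul_unitBall_subset b hr) (hint.mono_set hball) φ ψ hφψ

/-- **`𝐌_{B(0,1)}((1/r)_* T) ≤ r^{-2p} 𝐌_{B(b,r)}(T)`** (Harvey: "𝐌_{B(0,1)}((1/r)_*(T)) =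
(1/r^p) 𝐌_{B(0,r)}(T)" for a current of real dimension `p`; here real dimension `2p`): for
admissible data, `0 < r`, `B(b,r) ⊆ Ω`. In particular bounded density ratios give a family of
blow-ups of bounded mass. [cite: Harvey1977, §1.10] -/
theorem HolomorphicChain.mass_blowUp_le (T : HolomorphicChain 𝓘(ℂ, V) Ω p)
    (hT : letI : InnerProductSpace ℝ V := InnerProductSpace.complexToReal
      IsRectifiableData Ω (2 * p) T.carrier T.density T.orientationFrame)
    {b : V} {r : ℝ} (hr : 0 < r) (hball : Metric.ball b r ⊆ (Ω : Set V)) :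
    (T.blowUp b r).mass ≤ ENNReal.ofReal (r⁻¹ ^ (2 * p)) *
      (T.toCurrentIn (⟨Metric.ball b r, Metric.isOpen_ball⟩ : TopologicalSpace.Opens V)).mass := by
  letI : InnerProductSpace ℝ V := InnerProductSpace.complexToReal
  obtain ⟨hmeasW, -, -, hint, -⟩ := hT
  exact mass_currentOfIntegration_preimage_add_smul_le (Ω₁ := unitBall V)
    (Ω₂ := (⟨Metric.ball b r, Metric.isOpen_ball⟩ : TopologicalSpace.Opens V)) hmeasW T.density
    T.orientationFrame b hr (image_add_smul_unitBall_subset b hr) (hint.mono_set hball)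

/-- **Blow-ups of holomorphic chains are cycles**: for a chain of positive dimension `p = q + 1`
with admissible data and `∂[T] = 0` on `Ω`, and `0 < r`, `B(b,r) ⊆ Ω`:
`∂((1/r)_*(τ_{-b})_*[T]) = 0` on `B(0,1)` (restriction to `B(b,r)` and push-forward both commute
with `∂`). [cite: Federer1969, 4.1.14] -/
theorem HolomorphicChain.boundary_blowUp_eq_zero {q : ℕ} (T : HolomorphicChain 𝓘(ℂ, V) Ω (q + 1))
    (hT : letI : InnerProductSpace ℝ V := InnerProductSpace.complexToReal
      IsRectifiableData Ω (2 * (q + 1)) T.carrier T.density T.orientationFrame)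
    (h0 : T.boundary = 0) {b : V} {r : ℝ} (hr : 0 < r) (hball : Metric.ball b r ⊆ (Ω : Set V)) :
    Current.boundary (T.blowUp b r : Current (unitBall V) (2 * q + 1 + 1)) = 0 := by
  letI : InnerProductSpace ℝ V := InnerProductSpace.complexToReal
  obtain ⟨hmeasW, -, -, hint, -⟩ := hT
  have hle : (⟨Metric.ball b r, Metric.isOpen_ball⟩ : TopologicalSpace.Opens V) ≤ Ω := hball
  have h1 : Current.boundary (currentOfIntegration T.carrier T.density T.orientationFrame :
      Current (⟨Metric.ball b r, Metric.isOpen_ball⟩ : TopologicalSpace.Opens V) (2 * q + 1 + 1)) = 0 :=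
    currentOfIntegration_boundary_eq_zero_of_le hle hint h0
  exact boundary_currentOfIntegration_preimage_add_smul_eq_zero (Ω₁ := unitBall V)
    (Ω₂ := (⟨Metric.ball b r, Metric.isOpen_ball⟩ : TopologicalSpace.Opens V)) hmeasW T.density
    T.orientationFrame b hr (image_add_smul_unitBall_subset b hr) (hint.mono_set hball) h1

/-- `HolomorphicChain.mass_blowUp_le` under the named fact `Harvey1977_isRectifiableData_toCurrent`.
[cite: Harvey1977, §1.10] -/
theorem HolomorphicChain.mass_blowUp_le' (h : Harvey1977_isRectifiableData_toCurrent.{u})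
    {V : Type u} [NormedAddCommGroup V] [InnerProductSpace ℂ V] [FiniteDimensional ℂ V]
    [MeasurableSpace V] [BorelSpace V] {Ω : TopologicalSpace.Opens V} {p : ℕ}
    (T : HolomorphicChain 𝓘(ℂ, V) Ω p) {b : V} {r : ℝ} (hr : 0 < r)
    (hball : Metric.ball b r ⊆ (Ω : Set V)) :
    (T.blowUp b r).mass ≤ ENNReal.ofReal (r⁻¹ ^ (2 * p)) *
      (T.toCurrentIn (⟨Metric.ball b r, Metric.isOpen_ball⟩ : TopologicalSpace.Opens V)).mass :=
  T.mass_blowUp_le (h V Ω p T) hr hball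

/-- `HolomorphicChain.boundary_blowUp_eq_zero` under the named facts
`Harvey1977_isRectifiableData_toCurrent` and `Harvey1977_boundary_toCurrent_eq_zero`: blow-ups of
holomorphic chains are cycles on `B(0,1)`. [cite: Harvey1977, Lemma 1.8] -/
theorem HolomorphicChain.boundary_blowUp_eq_zero' (h : Harvey1977_isRectifiableData_toCurrent.{u})
    (h' : Harvey1977_boundary_toCurrent_eq_zero.{u})
    {V : Type u} [NormedAddCommGroup V] [InnerProductSpace ℂ V] [FiniteDimensional ℂ V]
    [MeasurableSpace V] [BorelSpace V] {Ω : TopologicalSpace.Opens V} {q : ℕ}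
    (T : HolomorphicChain 𝓘(ℂ, V) Ω (q + 1)) {b : V} {r : ℝ} (hr : 0 < r)
    (hball : Metric.ball b r ⊆ (Ω : Set V)) :
    Current.boundary (T.blowUp b r : Current (unitBall V) (2 * q + 1 + 1)) = 0 :=
  T.boundary_blowUp_eq_zero (h V Ω (q + 1) T) (h' V Ω q T) hr hball

end BlowUpMass

end Literature.Geometry.Kaehler
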